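import Literature.NumberTheory.Automorphic.MirabolicTower
import Literature.NumberTheory.Automorphic.AdeleQuotientPiFourier
import HarnessLib

/-!
# Fourier analysis on the column groups `Y(K) \ Y(𝔸_K) ≅ (𝔸_K ⧸ K)^d`: Bessel's inequality for
integrals over the Tate box

Topic `NumberTheory/Automorphic`; namespace `Literature.NumberTheory.Automorphic`. The column group
`Y_c = U_{[c,c]} ≤ N_n` (`adelicColRange n K c c`: unitriangular matrices with non-trivial entries only in
the column `c`, rows `< c`) is the additive group `𝔾_a^{c}` written multiplicatively; this file makes
the dictionary between

* functions `F` on `Y_c(𝔸_K)` invariant under the lattice `Y_c(K)` and their integrals over the Tate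
  box `box = colRangeTateDomain n K c c` for a Haar measure `μ_Y` of `Y_c(𝔸_K)`, and
* functions on the compact group `(𝔸_K ⧸ K)^{ColIdx n c}` with its Haar probability measure
  (`AdeleQuotientPiFourier`),

and draws **Bessel's inequality in box form**: for `F` continuous and `Y_c(K)`-invariant and every finite
set `S` of frequencies `η : ColIdx n c → K`,

  `Σ_{η ∈ S} |μ_Y(box)⁻¹ ∫_{box} conj ψ_η(y) F(y) dμ_Y|² ≤ μ_Y(box)⁻¹ ∫_{box} |F|² dμ_Y`,

`ψ_η(y) = ψ(Σ_i η_i y_{i,c})` (`colChar`), the inequality behind each step of the Fourier–Whittaker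
recursion (Cogdell (2004), §1.1, proof of Thm. 1.1: "expand along `Y(k)\Y(𝔸) ≅ (k\𝔸)^{n-1}`";
Jacquet–Shalika (1981), §4). Contents, all proved:

* `colVec x` — the element of `Y_c(𝔸_K)`… over any commutative ring: `colVecGL c hc x ∈ U_{[c,c]}` with
  entries `x : ColIdx n c → R` in the column `c` (`hc : c < n`); `colVecGL_add` (`x ↦ colVec x` turns
  sums into products), `colVecGL_entry` / `colVecGL_colEntry` (it is inverse to reading off the column);
* over `𝔸_K`: `colVecHomeomorph : (ColIdx n c → 𝔸_K) ≃ₜ Y_c(𝔸_K)`; the image of `D^{ColIdx}` is the box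
  (`image_colVecHomeomorph_pi`); rational vectors go to the lattice (`colVecY_algebraMap_mem`);
* `isHaarMeasure_map_colVecHomeomorph` — the image of `⊗ λ` (`λ` an additive Haar measure of `𝔸_K`) is a
  Haar measure of `Y_c(𝔸_K)`, so every Haar measure `μ_Y` is a multiple of it
  (`haar_eq_smul_map_colVec`);
* `colChar η` and `colChar_colVecY` (`= ψ(Σ η_i x_i)`), `colChar_mul` ;
* `periodicDescent` of a `Y_c(K)`-invariant function to `(𝔸_K ⧸ K)^{ColIdx}` and its continuity;
* `integral_box_eq_smul_integral_quot` — `∫_{box} G(y) dμ_Y = μ_Y(box) • ∫ Ḡ d(Haar prob)` for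
  `G = H ∘ (class of colVec⁻¹ ·)`;
* `sum_norm_sq_boxCoeff_le` — **Bessel's inequality in box form** (and `tsum` form).

## References

* J. W. Cogdell, *Analytic theory of L-functions for GL_n*, in *An Introduction to the Langlands
  Program* (2004), §1.1 [CogdellAnalyticTheory2004].
* H. Jacquet, J. A. Shalika, *On Euler products and the classification of automorphic
  representations I*, Amer. J. Math. 103 (1981), §4 [JacquetShalikaAJM1981].
-/

noncomputable section

open MeasureTheory Measure NumberField IsDedekindDomain Matrix Set Filter Topology
open scoped MatrixGroups ENNReal NNReal ComplexConjugate

namespace Literature.NumberTheory.Automorphic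

/-! ### The column vector parametrisation over a commutative ring -/

section Ring

variable {n : ℕ} {R : Type*} [CommRing R] (c : ℕ)

/-- The entries of the column matrix with column vector `x`: `x_i` at `(i, c)`, `i < c`. [folklore] -/
def colEntries (x : ColIdx n c → R) (i j : Fin n) : R :=
  if h : (i : ℕ) < c ∧ (j : ℕ) = c then x ⟨i, h.1⟩ else 0

/-- **The column matrix `colVecGL c hc x ∈ GL_n(R)`**: the unitriangular matrix with the vector `x` in
the column `c` above the diagonal (`unitriangularGL` of `UnipotentAdelicCompact`). [folklore] -/
def colVecGL (x : ColIdx n c → R) : GL (Fin n) R :=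
  unitriangularGL (colEntries c x)

/-- Entries of `colVecGL` above the diagonal. [folklore] -/
theorem colVecGL_apply_of_lt (x : ColIdx n c → R) {i j : Fin n} (hij : i < j) :
    ((colVecGL c x : GL (Fin n) R) : Matrix (Fin n) (Fin n) R) i j =
      if h : (i : ℕ) < c ∧ (j : ℕ) = c then x ⟨i, h.1⟩ else 0 := by
  rw [colVecGL, coe_unitriangularGL, unitriangularOfEntries_apply, if_neg (ne_of_lt hij), if_pos hij]
  rfl

/-- `colVecGL c x` lies in the column group `U_{[c,c]}`. [folklore] -/
theorem colVecGL_mem (x : ColIdx n c → R) : colVecGL c x ∈ unipotentColRange n R c c := by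
  refine mem_unipotentColRange_of (unitriangularGL_mem _) fun i j hij hj => ?_
  rw [colVecGL_apply_of_lt c x hij, dif_neg]
  rintro ⟨-, h2⟩
  exact hj ⟨le_of_eq h2.symm, le_of_eq h2⟩

/-- **The column entry recovers the vector**: `(colVecGL c x)_{i,c} = x_i` for `i < c`. [folklore] -/
theorem colVecGL_colEntry (hc : c < n) (x : ColIdx n c → R) (i : ColIdx n c) :
    ((colVecGL c x : GL (Fin n) R) : Matrix (Fin n) (Fin n) R) i.1 ⟨c, hc⟩ = x i := by
  have hij : i.1 < (⟨c, hc⟩ : Fin n) := Fin.lt_def.2 (by simpa using i.2)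
  rw [colVecGL_apply_of_lt c x hij, dif_pos ⟨i.2, rfl⟩]

/-- **Every element of `U_{[c,c]}` is a column matrix**: `u = colVecGL c (i ↦ u_{i,c})`. [folklore] -/
theorem colVecGL_entries_eq (hc : c < n) {u : GL (Fin n) R} (hu : u ∈ unipotentColRange n R c c) :
    colVecGL c (fun i : ColIdx n c => (u : Matrix (Fin n) (Fin n) R) i.1 ⟨c, hc⟩) = u := by
  obtain ⟨hut, hud⟩ := (mem_upperUnitriangular_iff u).1 hu.1
  refine Units.ext (Matrix.ext fun i j => ?_)
  rcases lt_trichotomy i j with hij | rfl | hji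
  · rw [colVecGL_apply_of_lt c _ hij]
    by_cases h : (i : ℕ) < c ∧ (j : ℕ) = c
    · rw [dif_pos h]
      have : (⟨c, hc⟩ : Fin n) = j := Fin.ext h.2.symm
      subst this
      rfl
    · rw [dif_neg h]
      symm
      by_cases hj : (j : ℕ) = c
      · have hi : ¬ (i : ℕ) < c := fun hi => h ⟨hi, hj⟩
        exfalso
        have := Fin.lt_def.1 hij
        omega
      · exact hu.2 i j (ne_of_lt hij) fun hr => hj (le_antisymm hr.2 hr.1)
  · rw [apply_of_le (colVecGL_mem c _) le_rfl, if_pos rfl, hud]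
  · rw [apply_of_le (colVecGL_mem c _) hji.le, if_neg (ne_of_gt hji), hut hji]

/-- **`x ↦ colVecGL c x` turns sums into products** (the column group is `𝔾_a^c` written
multiplicatively: `(u v)_{i,c} = u_{i,c} + v_{i,c}` since `u_{ik} = 0` for `i < k < c`… `k ≠ c`).
[folklore] -/
theorem colVecGL_add (hc : c < n) (x x' : ColIdx n c → R) : colVecGL c (x + x') = colVecGL c x * colVecGL c x' := by
  have hmem : colVecGL c x * colVecGL c x' ∈ unipotentColRange n R c c :=
    (unipotentColRange n R c c).mul_mem (colVecGL_mem c x) (colVecGL_mem c x')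
  rw [← colVecGL_entries_eq c hc hmem]
  congr 1
  funext i
  have hu := (mem_upperUnitriangular_iff _).1 (colVecGL_mem c x).1
  have hv := (mem_upperUnitriangular_iff _).1 (colVecGL_mem c x').1
  have hij : i.1 < (⟨c, hc⟩ : Fin n) := Fin.lt_def.2 (by simpa using i.2)
  rw [Units.val_mul, unitriangular_mul_apply_of_lt hu.1 hu.2 hv.1 hv.2 hij, colVecGL_colEntry c hc,
    colVecGL_colEntry c hc, Pi.add_apply]
  rw [Finset.sum_eq_zero, add_zero, add_comm]
  intro k hk
  simp only [Finset.mem_filter, Finset.mem_univ, true_and] at hk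
  -- `(colVecGL c x)_{i k} = 0` for `k < c` (`k ≠ c`)
  have hkc : (k : ℕ) ≠ c := by
    have := Fin.lt_def.1 hk.2; simp at this; omega
  rw [colVecGL_apply_of_lt c x hk.1, dif_neg (fun h => hkc h.2), zero_mul]

/-- `colVecGL c 0 = 1`. [folklore] -/
theorem colVecGL_zero (hc : c < n) : colVecGL c (0 : ColIdx n c → R) = 1 := by
  have h := colVecGL_add c hc (0 : ColIdx n c → R) 0
  rw [add_zero] at h
  have h2 := congrArg (fun g => (colVecGL c (0 : ColIdx n c → R))⁻¹ * g) h
  simp only [inv_mul_cancel, inv_mul_cancel_left] at h2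
  exact h2.symm

/-- `colVecGL c (-x) = (colVecGL c x)⁻¹`. [folklore] -/
theorem colVecGL_neg (hc : c < n) (x : ColIdx n c → R) : colVecGL c (-x) = (colVecGL c x)⁻¹ := by
  rw [eq_inv_iff_mul_eq_one, ← colVecGL_add c hc, neg_add_cancel, colVecGL_zero c hc]

/-- **Naturality** in the ring. [folklore] -/
theorem map_colVecGL (hc : c < n) {S : Type*} [CommRing S] (f : R →+* S) (x : ColIdx n c → R) :
    Matrix.GeneralLinearGroup.map f (colVecGL c x) = colVecGL c (f ∘ x) := by
  have hmem : Matrix.GeneralLinearGroup.map f (colVecGL c x) ∈ unipotentColRange n S c c :=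
    map_mem_unipotentColRange f (colVecGL_mem c x)
  rw [← colVecGL_entries_eq c hc hmem]
  congr 1
  funext i
  change f (((colVecGL c x : GL (Fin n) R) : Matrix (Fin n) (Fin n) R) i.1 ⟨c, hc⟩) = f (x i)
  rw [colVecGL_colEntry c hc]

end Ring

/-! ### The adelic column group as a homeomorphic image of `𝔸_K^{ColIdx}` -/

section Adelic

variable {n : ℕ} {K : Type} [Field K] [NumberField K] (c : ℕ)

/-- The column element of `Y_c(𝔸_K)` with vector `x`. [folklore] -/
def colVecY (x : ColIdx n c → AdeleRing (𝓞 K) K) : ↥(adelicColRange n K c c) :=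
  ⟨colVecGL c x, colVecGL_mem c x⟩

/-- Its underlying matrix (definitional). [folklore] -/
@[simp]
theorem coe_colVecY (x : ColIdx n c → AdeleRing (𝓞 K) K) :
    ((colVecY (n := n) (K := K) c x : ↥(adelicColRange n K c c)) : GL (Fin n) (AdeleRing (𝓞 K) K)) =
      colVecGL c x := rfl

/-- `colVecY` is additive-to-multiplicative. [folklore] -/
theorem colVecY_add (hc : c < n) (x x' : ColIdx n c → AdeleRing (𝓞 K) K) :
    colVecY (n := n) (K := K) c (x + x') = colVecY c x * colVecY c x' :=
  Subtype.ext (colVecGL_add c hc x x')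

/-- **The homeomorphism `𝔸_K^{ColIdx n c} ≃ₜ Y_c(𝔸_K)`**, `x ↦ colVec x` (inverse: the column entries;
continuity of the entries, `continuous_unitriangularGL`). [folklore] -/
def colVecHomeomorph (hc : c < n) : (ColIdx n c → AdeleRing (𝓞 K) K) ≃ₜ ↥(adelicColRange n K c c) where
  toFun := colVecY c
  invFun u i := ((u : GL (Fin n) (AdeleRing (𝓞 K) K)) : Matrix (Fin n) (Fin n) (AdeleRing (𝓞 K) K)) i.1 ⟨c, hc⟩
  left_inv x := funext fun i => colVecGL_colEntry c hc x i
  right_inv u := Subtype.ext (colVecGL_entries_eq c hc u.2)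
  continuous_toFun := by
    refine Continuous.subtype_mk ?_ _
    change Continuous fun x : ColIdx n c → AdeleRing (𝓞 K) K => unitriangularGL (colEntries c x)
    refine continuous_unitriangularGL.comp (continuous_pi fun i => continuous_pi fun j => ?_)
    unfold colEntries
    split_ifs with h
    · exact continuous_apply _
    · exact continuous_const
  continuous_invFun :=
    continuous_pi fun i => (continuous_adelicColRange_apply i.1 ⟨c, hc⟩)

/-- `colVecHomeomorph c hc x = colVecY c x` (definitional). [folklore] -/
@[simp]
theorem colVecHomeomorph_apply (hc : c < n) (x : ColIdx n c → AdeleRing (𝓞 K) K) :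
    colVecHomeomorph (n := n) (K := K) c hc x = colVecY c x := rfl

/-- **The image of `D^{ColIdx}` is the Tate box of `Y_c`** (the out-of-column entries are `0 ∈ D`).
[folklore] -/
theorem image_colVecHomeomorph_pi (hc : c < n) :
    colVecHomeomorph (n := n) (K := K) c hc '' Set.pi Set.univ (fun _ : ColIdx n c => adeleFundamentalDomain K) =
      colRangeTateDomain n K c c := by
  ext u
  constructor
  · rintro ⟨x, hx, rfl⟩
    intro i j hij
    change ((colVecGL c x : GL (Fin n) (AdeleRing (𝓞 K) K)) : Matrix (Fin n) (Fin n) (AdeleRing (𝓞 K) K)) i j ∈ _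
    rw [colVecGL_apply_of_lt c x hij]
    split_ifs with h
    · exact hx ⟨i, h.1⟩ (Set.mem_univ _)
    · exact zero_mem_adeleFundamentalDomain K
  · intro hu
    refine ⟨(colVecHomeomorph c hc).symm u, fun i _ => ?_, (colVecHomeomorph c hc).apply_symm_apply u⟩
    exact hu i.1 ⟨c, hc⟩ (Fin.lt_def.2 (by simpa using i.2))

/-- **Rational vectors go to the lattice**: `colVec (ξ) ∈ Y_c(K)` for `ξ : ColIdx n c → K`.
[folklore] -/
theorem colVecY_algebraMap_mem (hc : c < n) (ξ : ColIdx n c → K) :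
    colVecY (n := n) (K := K) c (fun i => algebraMap K (AdeleRing (𝓞 K) K) (ξ i)) ∈ rationalColRange n K c c := by
  refine ⟨(colVecGL c ξ : GL (Fin n) K), ?_⟩
  change Matrix.GeneralLinearGroup.map (algebraMap K (AdeleRing (𝓞 K) K)) (colVecGL c ξ) = colVecGL c _
  rw [map_colVecGL c hc]
  rfl

/-- **Lattice elements are rational column vectors**: every `γ ∈ Y_c(K)` is `colVec (ξ)` with
`ξ : ColIdx n c → K`. [folklore] -/
theorem exists_eq_colVecY_algebraMap (hc : c < n) {γ : ↥(adelicColRange n K c c)} (hγ : γ ∈ rationalColRange n K c c) :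
    ∃ ξ : ColIdx n c → K, γ = colVecY c (fun i => algebraMap K (AdeleRing (𝓞 K) K) (ξ i)) := by
  obtain ⟨g, hg⟩ := (mem_rationalColRange_iff γ).1 hγ
  refine ⟨fun i => (g : Matrix (Fin n) (Fin n) K) i.1 ⟨c, hc⟩, Subtype.ext ?_⟩
  rw [coe_colVecY, ← colVecGL_entries_eq c hc γ.2]
  congr 1
  funext i
  rw [← hg]
  rfl

/-! ### Haar measure transport -/

variable [MeasurableSpace (GL (Fin n) (AdeleRing (𝓞 K) K))] [BorelSpace (GL (Fin n) (AdeleRing (𝓞 K) K))]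
  [MeasurableSpace (AdeleRing (𝓞 K) K)] [BorelSpace (AdeleRing (𝓞 K) K)]

attribute [local instance] secondCountableTopology_adeleRing locallyCompactSpace_adeleRing'

/-- **The image of `⊗ λ` under `x ↦ colVec x` is a Haar measure of `Y_c(𝔸_K)`**: left multiplication
by `colVec x₀` corresponds to translation by `x₀` (`colVecY_add`), which preserves `⊗ λ`; finiteness on
compacts and positivity on opens transfer along the homeomorphism. [folklore] -/
theorem isHaarMeasure_map_colVecHomeomorph (hc : c < n) (lam : Measure (AdeleRing (𝓞 K) K)) [lam.IsAddHaarMeasure] :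
    IsHaarMeasure ((Measure.pi fun _ : ColIdx n c => lam).map (colVecHomeomorph (n := n) (K := K) c hc)) := by
  haveI := t2Space_adeleRing K
  set E := colVecHomeomorph (n := n) (K := K) c hc with hE_def
  have hE : Measurable E := E.continuous.measurable
  haveI : ((Measure.pi fun _ : ColIdx n c => lam).map E).IsMulLeftInvariant := by
    refine ⟨fun u => ?_⟩
    obtain ⟨x₀, rfl⟩ := E.surjective u
    rw [map_map (measurable_const_mul _) hE]
    have hcomp : ((E x₀ * ·) ∘ E) = E ∘ fun x => x₀ + x := by
      funext x
      change colVecY c x₀ * colVecY c x = colVecY c (x₀ + x)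
      rw [colVecY_add c hc]
    rw [hcomp, ← map_map hE (measurable_const_add x₀), map_add_left_eq_self]
  refine { lt_top_of_isCompact := fun C hC => ?_, open_pos := fun U hU hne => ?_ }
  · rw [map_apply hE hC.measurableSet]
    exact (E.isCompact_preimage.2 hC).measure_lt_top
  · rw [map_apply hE hU.measurableSet]
    exact (hU.preimage E.continuous).measure_ne_zero _ (hne.preimage E.surjective)

/-- **Every Haar measure of `Y_c(𝔸_K)` is a multiple of the transported `⊗ λ`**, with a constant in
`(0, ∞)`. [folklore] -/
theorem haar_eq_smul_map_colVec (hc : c < n) (lam : Measure (AdeleRing (𝓞 K) K)) [lam.IsAddHaarMeasure] (μY : Measure ↥(adelicColRange n K c c)) [IsHaarMeasure μY] :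
    ∃ a : ℝ≥0∞, a ≠ 0 ∧ a ≠ ∞ ∧
      μY = a • (Measure.pi fun _ : ColIdx n c => lam).map (colVecHomeomorph (n := n) (K := K) c hc) := by
  haveI := isHaarMeasure_map_colVecHomeomorph c hc lam
  refine ⟨haarScalarFactor μY ((Measure.pi fun _ : ColIdx n c => lam).map (colVecHomeomorph c hc)), ?_,
    ENNReal.coe_ne_top, ?_⟩
  · exact_mod_cast (haarScalarFactor_pos_of_isHaarMeasure μY _).ne'
  · have h := isMulLeftInvariant_eq_smul μY ((Measure.pi fun _ : ColIdx n c => lam).map (colVecHomeomorph c hc))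
    conv_lhs => rw [h]
    rfl

/-- **Integration over `Y_c(𝔸_K)` in column coordinates**: `∫ G dμ_Y = a ∫ G(colVec x) d(⊗λ)(x)` with
the constant of `haar_eq_smul_map_colVec`; `ℝ≥0∞` form on a set `colVec '' A`. [folklore] -/
theorem lintegral_colRange_eq_mul_lintegral_pi (hc : c < n) (lam : Measure (AdeleRing (𝓞 K) K)) [lam.IsAddHaarMeasure] (μY : Measure ↥(adelicColRange n K c c)) [IsHaarMeasure μY] :
    ∃ a : ℝ≥0∞, a ≠ 0 ∧ a ≠ ∞ ∧ ∀ (G : ↥(adelicColRange n K c c) → ℝ≥0∞), Measurable G →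
      ∀ A : Set (ColIdx n c → AdeleRing (𝓞 K) K), MeasurableSet A →
        ∫⁻ y in colVecHomeomorph (n := n) (K := K) c hc '' A, G y ∂μY =
          a * ∫⁻ x in A, G (colVecY c x) ∂(Measure.pi fun _ : ColIdx n c => lam) := by
  obtain ⟨a, ha0, ha, hμ⟩ := haar_eq_smul_map_colVec c hc lam μY
  refine ⟨a, ha0, ha, fun G hG A hA => ?_⟩
  set E := colVecHomeomorph (n := n) (K := K) c hc with hE_def
  have hEm : MeasurableEmbedding E := E.toMeasurableEquiv.measurableEmbedding
  rw [hμ, Measure.restrict_smul, lintegral_smul_measure, smul_eq_mul]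
  congr 1
  rw [hEm.restrict_map, hEm.lintegral_map, Set.preimage_image_eq _ E.injective]
  rfl

/-! ### The characters `ψ_η` on `Y_c` and the periodic descent -/

/-- **The character `ψ_η` of `Y_c(𝔸_K)`**: `y ↦ ψ(Σ_i η_i y_{i,c})` for `η : ColIdx n c → K`
(`ψ = adeleAddChar K`, Tate's character). [folklore] -/
def colChar (hc : c < n) (η : ColIdx n c → K) (y : ↥(adelicColRange n K c c)) : Circle :=
  adeleAddChar K (∑ i : ColIdx n c, algebraMap K (AdeleRing (𝓞 K) K) (η i) *
    ((y : GL (Fin n) (AdeleRing (𝓞 K) K)) : Matrix (Fin n) (Fin n) (AdeleRing (𝓞 K) K)) i.1 ⟨c, hc⟩)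

omit [MeasurableSpace (GL (Fin n) (AdeleRing (𝓞 K) K))] [BorelSpace (GL (Fin n) (AdeleRing (𝓞 K) K))]
  [MeasurableSpace (AdeleRing (𝓞 K) K)] [BorelSpace (AdeleRing (𝓞 K) K)] in
/-- `ψ_η(colVec x) = ψ(Σ_i η_i x_i)`. [folklore] -/
theorem colChar_colVecY (hc : c < n) (η : ColIdx n c → K) (x : ColIdx n c → AdeleRing (𝓞 K) K) :
    colChar (n := n) (K := K) c hc η (colVecY c x) =
      adeleAddChar K (∑ i : ColIdx n c, algebraMap K (AdeleRing (𝓞 K) K) (η i) * x i) := by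
  unfold colChar
  congr 1
  refine Finset.sum_congr rfl fun i _ => ?_
  rw [coe_colVecY, colVecGL_colEntry c hc]

omit [MeasurableSpace (GL (Fin n) (AdeleRing (𝓞 K) K))] [BorelSpace (GL (Fin n) (AdeleRing (𝓞 K) K))]
  [MeasurableSpace (AdeleRing (𝓞 K) K)] [BorelSpace (AdeleRing (𝓞 K) K)] in
/-- `ψ_η(colVec x) = ψ_η(x mod K^ι)` in terms of the product character of `(𝔸_K ⧸ K)^ι`. [folklore] -/
theorem colChar_colVecY_eq_adeleQuotPiChar (hc : c < n) (η : ColIdx n c → K) (x : ColIdx n c → AdeleRing (𝓞 K) K) :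
    colChar (n := n) (K := K) c hc η (colVecY c x) = adeleQuotPiChar K η (mkPi K (ColIdx n c) x) := by
  rw [colChar_colVecY, ← adeleQuotPiChar_mk]
  rfl

omit [MeasurableSpace (GL (Fin n) (AdeleRing (𝓞 K) K))] [BorelSpace (GL (Fin n) (AdeleRing (𝓞 K) K))]
  [MeasurableSpace (AdeleRing (𝓞 K) K)] [BorelSpace (AdeleRing (𝓞 K) K)] in
/-- `ψ_η` is multiplicative on `Y_c(𝔸_K)`. [folklore] -/
theorem colChar_mul (hc : c < n) (η : ColIdx n c → K) (y y' : ↥(adelicColRange n K c c)) :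
    colChar (n := n) (K := K) c hc η (y * y') = colChar c hc η y * colChar c hc η y' := by
  obtain ⟨x, rfl⟩ := (colVecHomeomorph (n := n) (K := K) c hc).surjective y
  obtain ⟨x', rfl⟩ := (colVecHomeomorph (n := n) (K := K) c hc).surjective y'
  simp only [colVecHomeomorph_apply]
  rw [← colVecY_add c hc, colChar_colVecY, colChar_colVecY, colChar_colVecY, ← AddChar.map_add_eq_mul]
  congr 1
  rw [← Finset.sum_add_distrib]
  refine Finset.sum_congr rfl fun i _ => ?_
  rw [Pi.add_apply, mul_add]

omit [MeasurableSpace (GL (Fin n) (AdeleRing (𝓞 K) K))] [BorelSpace (GL (Fin n) (AdeleRing (𝓞 K) K))]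
  [MeasurableSpace (AdeleRing (𝓞 K) K)] [BorelSpace (AdeleRing (𝓞 K) K)] in
/-- `ψ_η` is trivial on the lattice `Y_c(K)`. [folklore] -/
theorem colChar_eq_one_of_mem_rational (hc : c < n) (η : ColIdx n c → K) {γ : ↥(adelicColRange n K c c)}
    (hγ : γ ∈ rationalColRange n K c c) : colChar (n := n) (K := K) c hc η γ = 1 := by
  obtain ⟨ξ, rfl⟩ := exists_eq_colVecY_algebraMap c hc hγ
  rw [colChar_colVecY]
  have : ∑ i : ColIdx n c, algebraMap K (AdeleRing (𝓞 K) K) (η i) * algebraMap K (AdeleRing (𝓞 K) K) (ξ i) =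
      algebraMap K (AdeleRing (𝓞 K) K) (∑ i, η i * ξ i) := by
    rw [_root_.map_sum]
    refine Finset.sum_congr rfl fun i _ => ?_
    rw [_root_.map_mul]
  rw [this]
  exact adeleAddChar_algebraMap K _

omit [MeasurableSpace (GL (Fin n) (AdeleRing (𝓞 K) K))] [BorelSpace (GL (Fin n) (AdeleRing (𝓞 K) K))]
  [MeasurableSpace (AdeleRing (𝓞 K) K)] [BorelSpace (AdeleRing (𝓞 K) K)] in
/-- `ψ_η` is continuous (as a `ℂ`-valued function). [folklore] -/
theorem continuous_colChar (hc : c < n) (η : ColIdx n c → K) :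
    Continuous fun y : ↥(adelicColRange n K c c) => (colChar (n := n) (K := K) c hc η y : ℂ) := by
  unfold colChar
  refine continuous_subtype_val.comp ((continuous_adeleAddChar K).comp ?_)
  exact continuous_finsetSum _ fun i _ => continuous_const.mul (continuous_adelicColRange_apply i.1 ⟨c, hc⟩)

/-- **The periodic descent.** A function `F` on `Y_c(𝔸_K)` invariant under left multiplication by the
lattice `Y_c(K)` defines a function on `(𝔸_K ⧸ K)^{ColIdx n c}`: `F̄(x mod K^ι) = F(colVec x)`
(defined through representatives). [folklore] -/
def periodicDescent {E : Type*} (F : ↥(adelicColRange n K c c) → E) (u : ColIdx n c → adeleQuotient K) : E :=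
  F (colVecY c fun i => Quotient.out (u i))

omit [MeasurableSpace (GL (Fin n) (AdeleRing (𝓞 K) K))] [BorelSpace (GL (Fin n) (AdeleRing (𝓞 K) K))]
  [MeasurableSpace (AdeleRing (𝓞 K) K)] [BorelSpace (AdeleRing (𝓞 K) K)] in
/-- **`F̄ ∘ mkPi = F ∘ colVec`** for `Y_c(K)`-invariant `F` (the representatives differ from `x` by
rational vectors, i.e. `colVec` of them by lattice elements). [folklore] -/
theorem periodicDescent_mkPi (hc : c < n) {E : Type*} {F : ↥(adelicColRange n K c c) → E}
    (hF : ∀ γ : ↥(adelicColRange n K c c), γ ∈ rationalColRange n K c c → ∀ y, F (γ * y) = F y)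
    (x : ColIdx n c → AdeleRing (𝓞 K) K) :
    periodicDescent (n := n) (K := K) c F (mkPi K (ColIdx n c) x) = F (colVecY c x) := by
  unfold periodicDescent
  -- `out (mk (x i)) = x i + k i` with `k i` principal
  have hk : ∀ i : ColIdx n c, ∃ ξ : K,
      (Quotient.out (mkPi K (ColIdx n c) x i) : AdeleRing (𝓞 K) K) = algebraMap K (AdeleRing (𝓞 K) K) ξ + x i := by
    intro i
    have h1 : (QuotientAddGroup.mk (Quotient.out (mkPi K (ColIdx n c) x i)) : adeleQuotient K) =
        QuotientAddGroup.mk (x i) := by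
      rw [mkPi_apply]
      exact Quotient.out_eq _
    rw [QuotientAddGroup.eq] at h1
    obtain ⟨ξ, hξ⟩ := h1
    refine ⟨-ξ, ?_⟩
    have hξ' : algebraMap K (AdeleRing (𝓞 K) K) ξ = -Quotient.out (mkPi K (ColIdx n c) x i) + x i := hξ
    rw [map_neg, hξ']
    abel
  choose ξ hξ using hk
  have hx : (fun i => (Quotient.out (mkPi K (ColIdx n c) x i) : AdeleRing (𝓞 K) K)) =
      (fun i => algebraMap K (AdeleRing (𝓞 K) K) (ξ i)) + x := funext fun i => by rw [hξ i]; rfl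
  rw [hx, colVecY_add c hc]
  exact hF _ (colVecY_algebraMap_mem c hc ξ) _

omit [MeasurableSpace (GL (Fin n) (AdeleRing (𝓞 K) K))] [BorelSpace (GL (Fin n) (AdeleRing (𝓞 K) K))]
  [MeasurableSpace (AdeleRing (𝓞 K) K)] [BorelSpace (AdeleRing (𝓞 K) K)] in
/-- `mkPi` is an open quotient map (a product of open quotient maps of groups). [folklore] -/
theorem isOpenQuotientMap_mkPi : IsOpenQuotientMap (mkPi K (ColIdx n c)) := by
  have h : ∀ _i : ColIdx n c, IsOpenQuotientMap
      (QuotientAddGroup.mk : AdeleRing (𝓞 K) K → adeleQuotient K) := fun _ =>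
    QuotientAddGroup.isOpenQuotientMap_mk
  exact IsOpenQuotientMap.piMap h

omit [MeasurableSpace (GL (Fin n) (AdeleRing (𝓞 K) K))] [BorelSpace (GL (Fin n) (AdeleRing (𝓞 K) K))]
  [MeasurableSpace (AdeleRing (𝓞 K) K)] [BorelSpace (AdeleRing (𝓞 K) K)] in
/-- The descent of a continuous invariant function is continuous (`mkPi` is a quotient map and
`F̄ ∘ mkPi = F ∘ colVec` is continuous). [folklore] -/
theorem continuous_periodicDescent (hc : c < n) {E : Type*} [TopologicalSpace E] {F : ↥(adelicColRange n K c c) → E}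
    (hFc : Continuous F)
    (hF : ∀ γ : ↥(adelicColRange n K c c), γ ∈ rationalColRange n K c c → ∀ y, F (γ * y) = F y) :
    Continuous (periodicDescent (n := n) (K := K) c F) := by
  rw [(isOpenQuotientMap_mkPi (n := n) (K := K) c).isQuotientMap.continuous_iff]
  have : periodicDescent (n := n) (K := K) c F ∘ mkPi K (ColIdx n c) = F ∘ colVecY c := by
    funext x; exact periodicDescent_mkPi c hc hF x
  rw [this]
  exact hFc.comp (colVecHomeomorph (n := n) (K := K) c hc).continuous

/-! ### Integrals over the box through the compact quotient, and Bessel's inequality -/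

variable [MeasurableSpace (adeleQuotient K)] [BorelSpace (adeleQuotient K)]

/-- **Box integrals are quotient integrals.** For a Haar measure `μ_Y` of `Y_c(𝔸_K)` and `H` on
`(𝔸_K ⧸ K)^{ColIdx}` (a.e.-strongly measurable for its Haar probability measure),
`∫_{box} H(x mod K^ι) dμ_Y(colVec x) = μ_Y(box) • ∫ H d(Haar prob)` — from the column coordinates
(`lintegral_colRange_eq_mul_lintegral_pi`), the box being `colVec(D^ι)`, and
`integral_pi_adeleFundamentalDomain_comp_mkPi`. Stated for `ℝ≥0∞`-valued `H`. [folklore] -/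
theorem lintegral_box_comp_eq_mul (hc : c < n) (μY : Measure ↥(adelicColRange n K c c)) [IsHaarMeasure μY]
    {H : (ColIdx n c → adeleQuotient K) → ℝ≥0∞} (hH : Measurable H) :
    ∫⁻ y in colRangeTateDomain n K c c, H (mkPi K (ColIdx n c) ((colVecHomeomorph (n := n) (K := K) c hc).symm y)) ∂μY =
      μY (colRangeTateDomain n K c c) * ∫⁻ u, H u ∂(adeleQuotPiHaar K (ColIdx n c)) := by
  set lam : Measure (AdeleRing (𝓞 K) K) := Measure.addHaar with hlam
  obtain ⟨a, ha0, ha, hint⟩ := lintegral_colRange_eq_mul_lintegral_pi c hc lam μY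
  have hDm : MeasurableSet (Set.pi Set.univ fun _ : ColIdx n c => adeleFundamentalDomain K) :=
    MeasurableSet.univ_pi fun _ => measurableSet_adeleFundamentalDomain K
  have hmeas : Measurable fun y : ↥(adelicColRange n K c c) =>
      H (mkPi K (ColIdx n c) ((colVecHomeomorph (n := n) (K := K) c hc).symm y)) :=
    hH.comp ((measurable_mkPi K (ColIdx n c)).comp (colVecHomeomorph c hc).symm.continuous.measurable)
  -- the box integral in coordinates
  have h1 := hint _ hmeas _ hDm
  rw [image_colVecHomeomorph_pi c hc] at h1
  have h1' : ∫⁻ y in colRangeTateDomain n K c c,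
      H (mkPi K (ColIdx n c) ((colVecHomeomorph (n := n) (K := K) c hc).symm y)) ∂μY =
      a * ∫⁻ x in Set.pi Set.univ (fun _ : ColIdx n c => adeleFundamentalDomain K),
        H (mkPi K (ColIdx n c) x) ∂(Measure.pi fun _ : ColIdx n c => lam) := by
    rw [h1]
    congr 1
    refine setLIntegral_congr_fun hDm fun x _ => ?_
    change H (mkPi K (ColIdx n c) ((colVecHomeomorph c hc).symm (colVecHomeomorph c hc x))) = _
    rw [Homeomorph.symm_apply_apply]
  -- the box volume in coordinates
  have h2 := hint (fun _ => 1) measurable_const _ hDm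
  rw [image_colVecHomeomorph_pi c hc, setLIntegral_const, setLIntegral_const, one_mul, one_mul,
    pi_pi_adeleFundamentalDomain] at h2
  rw [h1', lintegral_pi_adeleFundamentalDomain_comp_mkPi K (ColIdx n c) lam hH, h2, mul_assoc]

/-- **Box integrals are quotient integrals**, Bochner form: for `H` continuous on the compact group,
`∫_{box} H(x mod K^ι) dμ_Y = μ_Y(box).toReal • ∫ H d(Haar prob)`. [folklore] -/
theorem integral_box_comp_eq_smul (hc : c < n) (μY : Measure ↥(adelicColRange n K c c)) [IsHaarMeasure μY]
    {E' : Type*} [NormedAddCommGroup E'] [NormedSpace ℝ E']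
    {H : (ColIdx n c → adeleQuotient K) → E'} (hH : Continuous H) :
    ∫ y in colRangeTateDomain n K c c, H (mkPi K (ColIdx n c) ((colVecHomeomorph (n := n) (K := K) c hc).symm y)) ∂μY =
      (μY (colRangeTateDomain n K c c)).toReal • ∫ u, H u ∂(adeleQuotPiHaar K (ColIdx n c)) := by
  set lam : Measure (AdeleRing (𝓞 K) K) := Measure.addHaar with hlam
  obtain ⟨a, ha0, ha, hμ⟩ := haar_eq_smul_map_colVec c hc lam μY
  set E := colVecHomeomorph (n := n) (K := K) c hc with hE_def
  have hEm : MeasurableEmbedding E := E.toMeasurableEquiv.measurableEmbedding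
  have hDm : MeasurableSet (Set.pi Set.univ fun _ : ColIdx n c => adeleFundamentalDomain K) :=
    MeasurableSet.univ_pi fun _ => measurableSet_adeleFundamentalDomain K
  -- pass to coordinates
  have hbox : colRangeTateDomain n K c c = E '' Set.pi Set.univ (fun _ : ColIdx n c => adeleFundamentalDomain K) :=
    (image_colVecHomeomorph_pi c hc).symm
  have step1 : ∫ y in colRangeTateDomain n K c c, H (mkPi K (ColIdx n c) (E.symm y)) ∂μY =
      a.toReal • ∫ x in Set.pi Set.univ (fun _ : ColIdx n c => adeleFundamentalDomain K),
        H (mkPi K (ColIdx n c) x) ∂(Measure.pi fun _ : ColIdx n c => lam) := by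
    rw [hμ, Measure.restrict_smul, integral_smul_measure, hbox, hEm.restrict_map, hEm.integral_map,
      Set.preimage_image_eq _ E.injective]
    congr 1
    refine setIntegral_congr_fun hDm fun x _ => ?_
    rw [Homeomorph.symm_apply_apply]
  -- the fundamental-domain formula on `(𝔸_K ⧸ K)^ι`
  have step2 := integral_pi_adeleFundamentalDomain_comp_mkPi K (ColIdx n c) lam
    (F := H) hH.aestronglyMeasurable
  -- the box volume
  have hvol : (μY (colRangeTateDomain n K c c)).toReal =
      a.toReal * ((lam (adeleFundamentalDomain K)) ^ Fintype.card (ColIdx n c)).toReal := by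
    rw [hμ, Measure.smul_apply, hbox, Measure.map_apply E.continuous.measurable
      (hEm.measurableSet_image.2 hDm), Set.preimage_image_eq _ E.injective, pi_pi_adeleFundamentalDomain,
      smul_eq_mul, ENNReal.toReal_mul]
  rw [step1, step2, smul_smul, hvol]

/-- **The box Fourier coefficient is the quotient Fourier coefficient**: for `F` continuous and
`Y_c(K)`-invariant,
`∫_{box} conj ψ_η(y) F(y) dμ_Y = μ_Y(box).toReal • ∫ conj ψ_η(u) F̄(u) du`. [folklore] -/
theorem integral_box_conj_colChar_mul (hc : c < n) (μY : Measure ↥(adelicColRange n K c c)) [IsHaarMeasure μY]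
    {F : ↥(adelicColRange n K c c) → ℂ} (hFc : Continuous F)
    (hF : ∀ γ : ↥(adelicColRange n K c c), γ ∈ rationalColRange n K c c → ∀ y, F (γ * y) = F y)
    (η : ColIdx n c → K) :
    ∫ y in colRangeTateDomain n K c c, conj (colChar (n := n) (K := K) c hc η y : ℂ) * F y ∂μY =
      (μY (colRangeTateDomain n K c c)).toReal •
        ∫ u, conj (adeleQuotPiChar K η u : ℂ) * periodicDescent (n := n) (K := K) c F u
          ∂(adeleQuotPiHaar K (ColIdx n c)) := by
  have hH : Continuous fun u : ColIdx n c → adeleQuotient K =>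
      conj (adeleQuotPiChar K η u : ℂ) * periodicDescent (n := n) (K := K) c F u :=
    (Complex.continuous_conj.comp (continuous_adeleQuotPiChar K η)).mul
      (continuous_periodicDescent c hc hFc hF)
  rw [← integral_box_comp_eq_smul c hc μY hH]
  refine setIntegral_congr_fun measurableSet_colRangeTateDomain fun y _ => ?_
  -- `y = colVec x`
  obtain ⟨x, rfl⟩ := (colVecHomeomorph (n := n) (K := K) c hc).surjective y
  rw [Homeomorph.symm_apply_apply, colVecHomeomorph_apply, periodicDescent_mkPi c hc hF,
    ← colChar_colVecY_eq_adeleQuotPiChar c hc]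

/-- The same for `|F|²`: `∫_{box} ‖F‖² dμ_Y = μ_Y(box).toReal • ∫ ‖F̄‖²`. [folklore] -/
theorem integral_box_norm_sq (hc : c < n) (μY : Measure ↥(adelicColRange n K c c)) [IsHaarMeasure μY]
    {F : ↥(adelicColRange n K c c) → ℂ} (hFc : Continuous F)
    (hF : ∀ γ : ↥(adelicColRange n K c c), γ ∈ rationalColRange n K c c → ∀ y, F (γ * y) = F y) :
    ∫ y in colRangeTateDomain n K c c, ‖F y‖ ^ 2 ∂μY =
      (μY (colRangeTateDomain n K c c)).toReal •
        ∫ u, ‖periodicDescent (n := n) (K := K) c F u‖ ^ 2 ∂(adeleQuotPiHaar K (ColIdx n c)) := by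
  have hH : Continuous fun u : ColIdx n c → adeleQuotient K => ‖periodicDescent (n := n) (K := K) c F u‖ ^ 2 :=
    (continuous_periodicDescent c hc hFc hF).norm.pow 2
  rw [← integral_box_comp_eq_smul c hc μY hH]
  refine setIntegral_congr_fun measurableSet_colRangeTateDomain fun y _ => ?_
  obtain ⟨x, rfl⟩ := (colVecHomeomorph (n := n) (K := K) c hc).surjective y
  rw [Homeomorph.symm_apply_apply, colVecHomeomorph_apply, periodicDescent_mkPi c hc hF]

/-- **Bessel's inequality in box form.** Let `μ_Y` be a Haar measure of `Y_c(𝔸_K)`, `F` continuous on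
`Y_c(𝔸_K)` and invariant under left multiplication by `Y_c(K)`. Then for every finite set `S` of
frequencies `η : ColIdx n c → K`,
`Σ_{η ∈ S} ‖μ_Y(box)⁻¹ ∫_{box} conj ψ_η F dμ_Y‖² ≤ μ_Y(box)⁻¹ ∫_{box} ‖F‖² dμ_Y` — Bessel's inequality for
the orthonormal characters `ψ_η` of `(𝔸_K ⧸ K)^{ColIdx}` (`AdeleQuotientPiFourier`) transported to the
box (Cogdell (2004), §1.1). [folklore] -/
theorem sum_norm_sq_boxCoeff_le (hc : c < n) (μY : Measure ↥(adelicColRange n K c c)) [IsHaarMeasure μY]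
    {F : ↥(adelicColRange n K c c) → ℂ} (hFc : Continuous F)
    (hF : ∀ γ : ↥(adelicColRange n K c c), γ ∈ rationalColRange n K c c → ∀ y, F (γ * y) = F y)
    (S : Finset (ColIdx n c → K)) :
    ∑ η ∈ S, ‖(μY (colRangeTateDomain n K c c)).toReal⁻¹ •
        ∫ y in colRangeTateDomain n K c c, conj (colChar (n := n) (K := K) c hc η y : ℂ) * F y ∂μY‖ ^ 2 ≤
      (μY (colRangeTateDomain n K c c)).toReal⁻¹ * ∫ y in colRangeTateDomain n K c c, ‖F y‖ ^ 2 ∂μY := by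
  have hpos := measure_colRangeTateDomain_pos_of_isHaarMeasure μY
  have htop := measure_colRangeTateDomain_lt_top μY
  have hV : 0 < (μY (colRangeTateDomain n K c c)).toReal := ENNReal.toReal_pos hpos.ne' htop.ne
  have hcont := continuous_periodicDescent c hc hFc hF
  have hmem : MemLp (periodicDescent (n := n) (K := K) c F) 2 (adeleQuotPiHaar K (ColIdx n c)) :=
    memLp_two_of_continuous_pi K (ColIdx n c) hcont
  have hB := sum_norm_sq_integral_conj_adeleQuotPiChar_mul_le K (ColIdx n c) hmem S
  -- translate both sides
  have hcoef : ∀ η, (μY (colRangeTateDomain n K c c)).toReal⁻¹ •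
      ∫ y in colRangeTateDomain n K c c, conj (colChar (n := n) (K := K) c hc η y : ℂ) * F y ∂μY =
      ∫ u, conj (adeleQuotPiChar K η u : ℂ) * periodicDescent (n := n) (K := K) c F u
        ∂(adeleQuotPiHaar K (ColIdx n c)) := by
    intro η
    rw [integral_box_conj_colChar_mul c hc μY hFc hF η, smul_smul, inv_mul_cancel₀ hV.ne', one_smul]
  have hnorm : (μY (colRangeTateDomain n K c c)).toReal⁻¹ * ∫ y in colRangeTateDomain n K c c, ‖F y‖ ^ 2 ∂μY =
      ∫ u, ‖periodicDescent (n := n) (K := K) c F u‖ ^ 2 ∂(adeleQuotPiHaar K (ColIdx n c)) := by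
    rw [integral_box_norm_sq c hc μY hFc hF, smul_eq_mul, ← mul_assoc, inv_mul_cancel₀ hV.ne', one_mul]
  simp_rw [hcoef]
  rw [hnorm]
  exact hB

/-- **Bessel's inequality in box form**, series form: the squared normalised box coefficients are
summable with sum at most `μ_Y(box)⁻¹ ∫_{box} ‖F‖²`. [folklore] -/
theorem tsum_norm_sq_boxCoeff_le (hc : c < n) (μY : Measure ↥(adelicColRange n K c c)) [IsHaarMeasure μY]
    {F : ↥(adelicColRange n K c c) → ℂ} (hFc : Continuous F)
    (hF : ∀ γ : ↥(adelicColRange n K c c), γ ∈ rationalColRange n K c c → ∀ y, F (γ * y) = F y) :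
    Summable (fun η : ColIdx n c → K => ‖(μY (colRangeTateDomain n K c c)).toReal⁻¹ •
        ∫ y in colRangeTateDomain n K c c, conj (colChar (n := n) (K := K) c hc η y : ℂ) * F y ∂μY‖ ^ 2) ∧
    ∑' η : ColIdx n c → K, ‖(μY (colRangeTateDomain n K c c)).toReal⁻¹ •
        ∫ y in colRangeTateDomain n K c c, conj (colChar (n := n) (K := K) c hc η y : ℂ) * F y ∂μY‖ ^ 2 ≤
      (μY (colRangeTateDomain n K c c)).toReal⁻¹ * ∫ y in colRangeTateDomain n K c c, ‖F y‖ ^ 2 ∂μY := by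
  have hnn : ∀ η : ColIdx n c → K, 0 ≤ ‖(μY (colRangeTateDomain n K c c)).toReal⁻¹ •
      ∫ y in colRangeTateDomain n K c c, conj (colChar (n := n) (K := K) c hc η y : ℂ) * F y ∂μY‖ ^ 2 :=
    fun η => by positivity
  have hbound := sum_norm_sq_boxCoeff_le c hc μY hFc hF
  have hsum : Summable (fun η : ColIdx n c → K => ‖(μY (colRangeTateDomain n K c c)).toReal⁻¹ •
      ∫ y in colRangeTateDomain n K c c, conj (colChar (n := n) (K := K) c hc η y : ℂ) * F y ∂μY‖ ^ 2) :=
    summable_of_sum_le hnn hbound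
  exact ⟨hsum, hsum.tsum_le_of_sum_le hbound⟩

end Adelic

end Literature.NumberTheory.Automorphic
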